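import Summits.QuantumFields.YangMills.Theorems.UnitScaleTiltFluctuationComparisonRegPrRepAtHeightsLowerRow
import Summits.QuantumFields.YangMills.Theorems.AlphaInputsT3ACv3Data
import HarnessLib

/-!
# Crux `FluctuationComparisonRegPrL` (stmt-QuantumFields-19935), v3 re-base (skeleton v5j, OWNER RULING g19-№2): conjunct (A) `RepAtHeights` AT THE v3 DATUM
# `OfV3At.dataT3v3` — part 1: base row, integrability, main term at the heights, and the LOWER one-step trivial envelope from the v3 (α) rows
# (support file `--supports stmt-QuantumFields-19935`; ports of p502074 §1–§3 and p503151 §2 from `OfV2At.dataT3c`/`pkgAtV2` to `OfV3At.dataT3v3`/`pkgAtV3`)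

Fleet seat `ym-ust-19201-p2` (gen 4, v5j pen).  The v3 (α)-socket (`AlphaInputsT3ACv3`, ★pub-balaban3d-alpha-1: `OfV3At`, `pkgAtV3`, `dataT3v3`; owner RULING
g18-№3 / SUPPLEMENT A) replaces v2's floored-mass residual `Fibre49AC` by print's (55) with `χ_{k+1}` on the right over PINNED masses (`M(triv) ≡ 1`); every mass-free
row the (A) chain reads is re-delivered at the v3 record BY THE SAME NAMES (`PkgAtV3.{measurable_UkH, measurable_Pint, Pint_le, eps1_eq, θBal_pos, hU0}`,
`dataT3v3_{mainTermIsAction, uminTriv, rmSize, Ecst_eq, chi_eq, chi_eq_one_of_plaqSmall}`, `stepResidualsV3_of_alpha`).  WHAT THIS FILE PROVES for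
`D := h.dataT3v3 hc γ hγ hγ1 π`, CONDITIONAL on `h : OfV3At F 𝔠 a₀ a₁` only:
* §1 `BaseTrivAt D 𝔠.b₀ 𝔠.p₀ K` (level `0`: `U_0 = id`, `Pint_0 = 0`, `Ecst K 0 = 0`, `Rm_0 ≥ 0`);
* §2 `TrivExpIntegrable D` (data rows at every `j ≤ K`, `mainT ≥ 0`);
* §3 `MainTermAtHeights D 𝔠.b₀ 𝔠.p₀ ε₀` under the adapter's thresholds (r1 via `dataT3v3_uminTriv` below the cut-off; `minActionRegPr_self_of_plaqSmall`, p502074, at it);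
* §4 **`OfV3At.dataT3v3_oneStepLowerTrivAt`**: the lower one-step trivial envelope from the v3 step row `fibre57Low`, the lower gathering
  `LogComparisonRepAtHeights.ineq47_exponent_succ_le` (p503151) over the EIGHT v3 residual leaves (`stepResidualsV3_of_alpha`) + the series run identities, homogeneity of
  the transport for `e^{E}`, and the window dictionary.
Part 2 (`…RepAtHeightsV3.lean`): the upper envelope from `PkgAtV3.fibre55Win … (Hist.triv …)` and `OfV3At.repAtHeights_dataT3v3`.  Nothing of Bałaban's is asserted.

References: T. Bałaban, CMP 102 (1985) 255–275 [Balaban1985UV3] ((1)–(2) p.256, (37) p.265, (41)–(42) p.266, (47) p.267, (55)–(62) pp.269–271, p.272);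
CMP 102 (1985) 277–309 [Balaban1985Variational] ((2), (6) p.278, Thm 1 (8) p.279).
-/

set_option autoImplicit false

noncomputable section

namespace Summit.QuantumFields.YangMills.Theorems

open MeasureTheory Filter
open Literature.MathematicalPhysics.QuantumFieldTheory.Balaban1983to89
open Literature.MathematicalPhysics.QuantumFieldTheory.Balaban1983to89.AveragingRT (rnTransport)
open Literature.MathematicalPhysics.QuantumFieldTheory.Balaban1983to89.B10
open Literature.MathematicalPhysics.QuantumFieldTheory.Balaban1983to89.B10SectAGathering
open Literature.MathematicalPhysics.QuantumFieldTheory.Balaban1983to89.T3ContinuumYM3Torus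
open Literature.MathematicalPhysics.QuantumFieldTheory.Balaban1983to89.T3UnitLawDensityEML (ℰp rt)
open Literature.MathematicalPhysics.QuantumFieldTheory.Balaban1983to89.T3UnitScaleTilt (θBal)
open Literature.MathematicalPhysics.QuantumFieldTheory.Balaban1983to89.T3LevelShift (fieldShift fieldShift_refl)
open Literature.MathematicalPhysics.QuantumFieldTheory.Balaban1983to89.T3PrintedRegularMinimiser
open Literature.MathematicalPhysics.QuantumFieldTheory.Balaban1983to89.T3AlphaInputsAC
open Literature.MathematicalPhysics.QuantumFieldTheory.Balaban1983to89.T3AlphaInputsACTrivEnvelope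
open Literature.MathematicalPhysics.QuantumFieldTheory.Balaban1983to89.Missing (boltzmann)
open Literature.MathematicalPhysics.QuantumFieldTheory.Balaban1985CMP102
open Literature.MathematicalPhysics.QuantumFieldTheory.Balaban1985CMP102.Setting
open Summit.QuantumFields.Balaban3D.Carriers
open Summit.QuantumFields.Balaban3D.Proofs.Primitives
open Summit.QuantumFields.Balaban3D.Proofs.TowerAC
open Summit.QuantumFields.Balaban3D.Proofs.StandardAC
open Summit.QuantumFields.Balaban3D.Proofs.InputsAC
open Summit.QuantumFields.Balaban3D.Proofs.TowerFactsAC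
open Summit.QuantumFields.Balaban3D.Proofs.Bound55AC
open Summit.QuantumFields.Balaban3D.Proofs.Thm2AC
open Summit.QuantumFields.Balaban3D.Proofs (Bound55Std.measurable_actionEta Bound55Std.actionEta_nonneg)
open Summit.QuantumFields.YangMills.Theorems.LogComparisonRepAtHeights
open Summit.QuantumFields.YangMills.Theorems.AlphaV3AC (stepResidualsV3_of_alpha)

variable {F : T3Family} {𝔠 : AlphaConsts F.L (suGroupModel 2).N} {a₀ a₁ : ℝ}
  (h : AlphaInputsT3AC.OfV3At F 𝔠 a₀ a₁) (hc : 0 < a₀ ∧ 0 < a₁ ∧ 𝔠.B₃ * a₁ ≤ a₀) (γ : ℝ) (hγ : 0 < γ)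
  (hγ1 : γ ≤ (min 𝔠.gamma0 1) ^ 2) (π : AlphaInputsT3AC.PolymerT3 F)

/-! ## §1 Level `0` of every run and the base row -/

/-- `U_0(triv, W) = W` for the v3 datum (the package's `hU0`). [cite: Balaban1985UV3, (1) p.256] -/
theorem AlphaInputsT3AC.OfV3At.dataT3v3_umin_zero (K : ℕ) (W : GaugeField (F.P K) 0 (Matrix.specialUnitaryGroup (Fin 2) ℂ)) :
    (h.dataT3v3 hc γ hγ hγ1 π).Umin K 0 ((h.dataT3v3 hc γ hγ hγ1 π).triv K 0) W = W :=
  (h.pkgAtV3 hc γ hγ hγ1 K).hU0 W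

/-- `Pint_0 ≡ 0` for the v3 datum (`pintOfSeries` at level `0`). [cite: Balaban1985UV3, (1) p.256] -/
theorem AlphaInputsT3AC.OfV3At.dataT3v3_pint_zero (K : ℕ) (hh : (h.dataT3v3 hc γ hγ hγ1 π).Hist K 0)
    (W : GaugeField (F.P K) 0 (Matrix.specialUnitaryGroup (Fin 2) ℂ)) :
    (h.dataT3v3 hc γ hγ hγ1 π).Pint K 0 hh W = 0 :=
  rfl

/-- `mainT_0(triv, W) = β_K·A(W)` for the v3 datum (`MainTermIsAction` + `U_0 = id`). [cite: Balaban1985UV3, (1) p.256 and (5) p.256] -/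
theorem AlphaInputsT3AC.OfV3At.dataT3v3_mainT_triv_zero (K : ℕ) (W : GaugeField (F.P K) 0 (Matrix.specialUnitaryGroup (Fin 2) ℂ)) :
    (h.dataT3v3 hc γ hγ hγ1 π).mainT K 0 ((h.dataT3v3 hc γ hγ hγ1 π).triv K 0) W = (F.scheme ℰp γ).β K * wilsonAction4 W := by
  rw [h.dataT3v3_mainTermIsAction hc γ hγ hγ1 π K 0 _ W, h.dataT3v3_umin_zero hc γ hγ hγ1 π K W]

/-- `Ecst K 0 = 0` for the v3 datum (route normalisation). [cite: Balaban1985UV3, (62) p.271 and (64) p.273] -/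
theorem AlphaInputsT3AC.OfV3At.dataT3v3_Ecst_zero (K : ℕ) : (h.dataT3v3 hc γ hγ hγ1 π).Ecst K 0 = 0 := by
  rw [h.dataT3v3_Ecst_eq hc γ hγ hγ1 π K 0 (Nat.zero_le K), Finset.range_zero, Finset.sum_empty, neg_zero]

/-- **`BaseTrivAt` FOR THE v3 DATUM** at every cut-off. [cite: Balaban1985UV3, (1) p.256] -/
theorem AlphaInputsT3AC.OfV3At.dataT3v3_baseTrivAt (K : ℕ) : BaseTrivAt (h.dataT3v3 hc γ hγ hγ1 π) 𝔠.b₀ 𝔠.p₀ K := by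
  refine ae_of_all _ fun W _ => ?_
  have hR : 0 ≤ (h.dataT3v3 hc γ hγ hγ1 π).Rm K 0 := Rm_nonneg (h.dataT3v3_rmSize hc γ hγ hγ1 π) (Nat.zero_le K)
  rw [lowerTriv_eq_exp, upperTriv_eq_exp, h.dataT3v3_mainT_triv_zero hc γ hγ hγ1 π K W, h.dataT3v3_pint_zero hc γ hγ hγ1 π K _ W,
    h.dataT3v3_Ecst_zero hc γ hγ hγ1 π K]
  unfold boltzmann
  constructor
  · apply Real.exp_le_exp.mpr
    linarith
  · apply Real.exp_le_exp.mpr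
    linarith

/-! ## §2 Integrability of the trivial exponentials -/

/-- **`TrivExpIntegrable` FOR THE v3 DATUM**: `e^{−mainT_j(triv) + Pint_j(triv)}` is integrable at every level `j ≤ K` (data rows `PkgAtV3.measurable_UkH`,
`measurable_Pint`, `Pint_le` at every `j ≤ K`; `mainT ≥ 0`). [cite: Balaban1985UV3, (41) p.266] -/
theorem AlphaInputsT3AC.OfV3At.dataT3v3_trivExpIntegrable : TrivExpIntegrable (h.dataT3v3 hc γ hγ hγ1 π) := by
  intro K j hj
  have hU := (h.pkgAtV3 hc γ hγ hγ1 K).measurable_UkH j hj (Hist.triv (F.P K) j)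
  have hPm := (h.pkgAtV3 hc γ hγ hγ1 K).measurable_Pint j hj (Hist.triv (F.P K) j)
  have hPb := fun U => (h.pkgAtV3 hc γ hγ hγ1 K).Pint_le j hj (Hist.triv (F.P K) j) U
  show Integrable (fun W => Real.exp (-((h.pkgAtV3 hc γ hγ hγ1 K).T.mainT j (Hist.triv (F.P K) j) W) +
    (h.pkgAtV3 hc γ hγ hγ1 K).T.Pint j (Hist.triv (F.P K) j) W)) _
  have hmain : ∀ W : GaugeField (F.P K) j (Matrix.specialUnitaryGroup (Fin 2) ℂ),
      (h.pkgAtV3 hc γ hγ hγ1 K).T.mainT j (Hist.triv (F.P K) j) W =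
        ((T3Scales F γ hγ (hγ1.trans (sq_min_one_le _ 𝔠.gamma0_pos)) K).gk j)⁻¹ ^ 2 *
          (T3Scales F γ hγ (hγ1.trans (sq_min_one_le _ 𝔠.gamma0_pos)) K).actionEta j
            ((h.pkgAtV3 hc γ hγ hγ1 K).UkH j (Hist.triv (F.P K) j) W) := fun _ => rfl
  have h1 := Balaban3D.Proofs.Transport48.integrable_weight_mul_exp (P := F.P K) (G := Matrix.specialUnitaryGroup (Fin 2) ℂ)
    (m := fun _ => (1 : ℝ)) measurable_const (fun _ => zero_le_one) (fun _ => le_rfl)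
    (F := fun W => -((h.pkgAtV3 hc γ hγ hγ1 K).T.mainT j (Hist.triv (F.P K) j) W) +
      (h.pkgAtV3 hc γ hγ hγ1 K).T.Pint j (Hist.triv (F.P K) j) W) ?_ (c := (h.pkgAtV3 hc γ hγ hγ1 K).𝔄.cP j) ?_
  · exact h1.congr (ae_of_all _ fun W => one_mul _)
  · simp_rw [hmain]
    exact (measurable_const.mul ((Bound55Std.measurable_actionEta
      (S := T3Scales F γ hγ (hγ1.trans (sq_min_one_le _ 𝔠.gamma0_pos)) K) j).comp hU)).neg.add hPm
  · intro W
    have h0 : 0 ≤ (h.pkgAtV3 hc γ hγ hγ1 K).T.mainT j (Hist.triv (F.P K) j) W := by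
      rw [hmain]
      exact mul_nonneg (sq_nonneg _) (Bound55Std.actionEta_nonneg (S := T3Scales F γ hγ (hγ1.trans (sq_min_one_le _ 𝔠.gamma0_pos)) K) j _)
    have h2 : (h.pkgAtV3 hc γ hγ hγ1 K).T.Pint j (Hist.triv (F.P K) j) W ≤ (h.pkgAtV3 hc γ hγ hγ1 K).𝔄.cP j := hPb W
    linarith

/-! ## §3 The main term at the heights, including the cut-off height `n = K` -/

/-- At the cut-off height the composite minimiser at the trivial history IS the datum (index bookkeeping + `hU0`). [cite: Balaban1985UV3, (1) p.256] -/
theorem AlphaInputsT3AC.OfV3At.dataT3v3_umin_sub_self (K : ℕ) (V : GaugeField (F.P K) 0 (Matrix.specialUnitaryGroup (Fin 2) ℂ))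
    (e : (F.PP F.m K).sitesPerDir (K - K) = (F.PP F.m K).sitesPerDir 0) :
    (h.dataT3v3 hc γ hγ hγ1 π).Umin K (K - K) ((h.dataT3v3 hc γ hγ hγ1 π).triv K (K - K)) (fieldShift e V) = V := by
  have aux : ∀ (j : ℕ) (hj : j = 0) (e' : (F.PP F.m K).sitesPerDir j = (F.PP F.m K).sitesPerDir 0),
      (h.dataT3v3 hc γ hγ hγ1 π).Umin K j ((h.dataT3v3 hc γ hγ hγ1 π).triv K j) (fieldShift e' V) = V := by
    intro j hj e'
    subst hj
    rw [fieldShift_refl]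
    exact h.dataT3v3_umin_zero hc γ hγ hγ1 π K V
  exact aux (K - K) (Nat.sub_self K) e

/-- **`MainTermAtHeights` FOR THE v3 DATUM** under the adapter's thresholds: for `n < K` by r1 (`dataT3v3_uminTriv`) and `MainTermIsAction`; for `n = K` the fibre
is the datum itself (`minActionRegPr_self_of_plaqSmall`, p502074). [cite: Balaban1985UV3, (42) p.266; Balaban1985Variational, Thm 1 (8) p.279] -/
theorem AlphaInputsT3AC.OfV3At.dataT3v3_mainTermAtHeights (ε₀ : ℝ) (hε : 0 < ε₀) (hhi : ε₀ ≤ a₀)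
    (ha₁ : ∀ n, θBal F.L γ 𝔠.b₀ 𝔠.p₀ n ≤ a₁) (hlo : ∀ n, 𝔠.B₃ * θBal F.L γ 𝔠.b₀ 𝔠.p₀ n ≤ ε₀)
    (h4 : ∀ n, 4 * θBal F.L γ 𝔠.b₀ 𝔠.p₀ n < ε₀) :
    MainTermAtHeights (h.dataT3v3 hc γ hγ hγ1 π) 𝔠.b₀ 𝔠.p₀ ε₀ := by
  intro K n hn V hV
  rw [h.dataT3v3_mainTermIsAction hc γ hγ hγ1 π]
  congr 1
  rcases Nat.lt_or_eq_of_le hn with hlt | heq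
  · exact (h.dataT3v3_uminTriv hc γ hγ hγ1 π K n hlt ε₀ (ha₁ n) (hlo n) hhi V hV).2
  · subst heq
    rw [h.dataT3v3_umin_sub_self hc γ hγ hγ1 π n V]
    exact (minActionRegPr_self_of_plaqSmall (F := F) hn hε V hV (h4 n)).symm

/-! ## §4 The lower one-step trivial envelope of the v3 datum from the v3 (α) rows -/

/-- The window dictionary as an indicator identity for the v3 datum's characteristic function. [cite: Balaban1985UV3, (47) p.267] -/
theorem AlphaInputsT3AC.OfV3At.dataT3v3_chi_mul_eq_indicator (K j : ℕ) (hj : j ≤ K)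
    (f : GaugeField (F.P K) j (Matrix.specialUnitaryGroup (Fin 2) ℂ) → ℝ) (U : GaugeField (F.P K) j (Matrix.specialUnitaryGroup (Fin 2) ℂ)) :
    (h.dataT3v3 hc γ hγ hγ1 π).χ K j U * f U =
      {W' : GaugeField (F.P K) j (Matrix.specialUnitaryGroup (Fin 2) ℂ) | PlaqSmall (θBal F.L γ 𝔠.b₀ 𝔠.p₀ (K - j)) W'}.indicator f U := by
  rw [h.dataT3v3_chi_eq hc γ hγ hγ1 π K j hj U]
  unfold chiSmall
  by_cases hU : PlaqSmall (θBal F.L γ 𝔠.b₀ 𝔠.p₀ (K - j)) U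
  · rw [if_pos (show PlaqSmallOn Set.univ (θBal F.L γ 𝔠.b₀ 𝔠.p₀ (K - j)) U from fun q _ => hU q), one_mul,
      Set.indicator_of_mem (show U ∈ {W' | PlaqSmall (θBal F.L γ 𝔠.b₀ 𝔠.p₀ (K - j)) W'} from hU)]
  · rw [if_neg (fun hs : PlaqSmallOn Set.univ (θBal F.L γ 𝔠.b₀ 𝔠.p₀ (K - j)) U => hU fun q => hs q (Set.mem_univ q)), zero_mul,
      Set.indicator_of_notMem (show U ∉ {W' | PlaqSmall (θBal F.L γ 𝔠.b₀ 𝔠.p₀ (K - j)) W'} from hU)]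

/-- **THE LOWER ONE-STEP TRIVIAL ENVELOPE OF THE v3 DATUM — PROVED FROM THE v3 (α) ROWS**: for every run `K` and step `k < K`,
`OneStepLowerTrivAt (dataT3v3 …) 𝔠.b₀ 𝔠.p₀ K k` — the v3 step row `fibre57Low`, the lower gathering (p503151 `ineq47_exponent_succ_le`) over the eight residual leaves
`stepResidualsV3_of_alpha` + `starCount_piecesAC` + the series run identities `pintSucc_seriesAC`/`estep62_seriesAC`/`rmSucc_piecesAC`, homogeneity of the transport for
`e^{E}`, and the window dictionary. [cite: Balaban1985UV3, (37) p.265, (47) p.267 and p.272] -/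
theorem AlphaInputsT3AC.OfV3At.dataT3v3_oneStepLowerTrivAt (K k : ℕ) (hk : k + 1 ≤ K) :
    OneStepLowerTrivAt (h.dataT3v3 hc γ hγ hγ1 π) 𝔠.b₀ 𝔠.p₀ K k hk := by
  -- the package's data of run `K`, its v3 step row at `k`, the residual leaves, the gathering
  have hle := T3Scales_window F 𝔠 γ hγ hγ1 K
  have st := (h.pkgAtV3 hc γ hγ hγ1 K).run.steps k hk
  have R := stepResidualsV3_of_alpha hle k hk st
  have hgath := fun U => ineq47_exponent_succ_le (piecesAC 𝔠.lane (h.pkgAtV3 hc γ hγ hγ1 K).X (h.pkgAtV3 hc γ hγ hγ1 K).𝔖 k) hk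
    R.cumulantLower R.repr33_60 R.vacuumWhole R.decomp35_61 R.norm35
    (starCount_piecesAC 𝔠.lane (h.pkgAtV3 hc γ hγ hγ1 K).X (h.pkgAtV3 hc γ hγ hγ1 K).𝔖 k hk) R.oldOutside
    (((h.pkgAtV3 hc γ hγ hγ1 K).X.toTowerBase 𝔠.lane.carrier).pintSucc_seriesAC _ _ k)
    (((h.pkgAtV3 hc γ hγ hγ1 K).X.toTowerBase 𝔠.lane.carrier).estep62_seriesAC _ _ k)
    ((rmSucc_piecesAC 𝔠.lane (h.pkgAtV3 hc γ hγ hγ1 K).X (h.pkgAtV3 hc γ hγ hγ1 K).𝔖 k).mono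
      (by have := le_max_right 𝔠.lane.sc.C₁ 𝔠.lane.sc.C₁'; linarith)) U
  have h57 := st.fibre57Low
  have hint47 := hint47_stdAC (h.pkgAtV3 hc γ hγ hγ1 K).X 𝔠.lane.carrier (h.pkgAtV3 hc γ hγ hγ1 K).𝔖 (fun _ => True) k
    (st.hU _) (st.hPm _) ((h.pkgAtV3 hc γ hγ hγ1 K).𝔄.cP k) (st.hPb _)
  -- abbreviations in the tower's letters
  set T : TowerRun := (h.pkgAtV3 hc γ hγ hγ1 K).T with hT
  set E : ℝ := (h.pkgAtV3 hc γ hγ hγ1 K).E with hE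
  set P := piecesAC 𝔠.lane (h.pkgAtV3 hc γ hγ hγ1 K).X (h.pkgAtV3 hc γ hγ hγ1 K).𝔖 k with hP
  -- the integrand of the right side of `Fibre57LowAC` and its non-negativity
  set f : GaugeField (F.P K) k (Matrix.specialUnitaryGroup (Fin 2) ℂ) → ℝ := fun U =>
    T.χ k U * Real.exp (-(T.mainT k (T.triv k) U) + T.Pint k (T.triv k) U - T.Ecst k - T.Rm k) with hf
  have hf0 : ∀ U, 0 ≤ f U := fun U => mul_nonneg (T.χ_nonneg k U) (Real.exp_pos _).le
  have hfi : Integrable f (fieldMeasure (F.P K) k (Matrix.specialUnitaryGroup (Fin 2) ℂ)) := hint47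
  -- the transport of the route: `rt F K k` IS `rnTransport` over the pinned averaging `(p.X).av k = blockAvg ℰp`
  have hkm : k + 1 ≤ F.m + K := by omega
  have hav : ((h.pkgAtV3 hc γ hγ hγ1 K).X).av k = BlockAveraging.blockAvg (P := F.P K) (j := k) ℰp := avT3_of_le F K hkm
  have hrtT : ∀ g : GaugeField (F.P K) k (Matrix.specialUnitaryGroup (Fin 2) ℂ) → ℝ,
      (rt F K k hkm).T g = rnTransport (((h.pkgAtV3 hc γ hγ hγ1 K).X).av k).avg g := fun g => by
    rw [hav]; rfl
  -- the restricted lower envelope of level `k` IS `e^{E}·f`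
  have hind : {W' : GaugeField (F.P K) k (Matrix.specialUnitaryGroup (Fin 2) ℂ) | PlaqSmall (θBal F.L γ 𝔠.b₀ 𝔠.p₀ (K - k)) W'}.indicator
      (lowerTriv (h.dataT3v3 hc γ hγ hγ1 π) K k) = fun U => Real.exp E * f U := by
    funext U
    rw [← h.dataT3v3_chi_mul_eq_indicator hc γ hγ hγ1 π K k (by omega) _ U, lowerTriv_eq_exp]
    show T.χ k U * Real.exp ((-(T.mainT k (T.triv k) U) + T.Pint k (T.triv k) U - (T.Ecst k - E)) - T.Rm k) =
      Real.exp E * (T.χ k U * Real.exp (-(T.mainT k (T.triv k) U) + T.Pint k (T.triv k) U - T.Ecst k - T.Rm k))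
    rw [show (-(T.mainT k (T.triv k) U) + T.Pint k (T.triv k) U - (T.Ecst k - E)) - T.Rm k =
        E + (-(T.mainT k (T.triv k) U) + T.Pint k (T.triv k) U - T.Ecst k - T.Rm k) by ring, Real.exp_add]
    ring
  -- homogeneity of the transport under the constant `e^{E}`
  have hhom := rnTransport_const_mul_ae (((h.pkgAtV3 hc γ hγ hγ1 K).X).av k).avg f hf0 hfi (Real.exp_nonneg E)
  -- the goal
  show ∀ᵐ W ∂fieldMeasure (F.P K) (k + 1) (Matrix.specialUnitaryGroup (Fin 2) ℂ),
    PlaqSmall (θBal F.L γ 𝔠.b₀ 𝔠.p₀ (K - (k + 1))) W →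
      lowerTriv (h.dataT3v3 hc γ hγ hγ1 π) K (k + 1) W ≤
        (rt F K k hkm).T ({W' : GaugeField (F.P K) k (Matrix.specialUnitaryGroup (Fin 2) ℂ) |
          PlaqSmall (θBal F.L γ 𝔠.b₀ 𝔠.p₀ (K - k)) W'}.indicator (lowerTriv (h.dataT3v3 hc γ hγ hγ1 π) K k)) W
  rw [hind, hrtT]
  filter_upwards [h57, hhom] with W h57W hhomW
  intro hWs
  have hχ1 : T.χ (k + 1) W = 1 := h.dataT3v3_chi_eq_one_of_plaqSmall hc γ hγ hγ1 π K (k + 1) hk W hWs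
  have hexp : lowerTriv (h.dataT3v3 hc γ hγ hγ1 π) K (k + 1) W =
      Real.exp E * Real.exp (-(T.mainT (k + 1) (T.triv (k + 1)) W) + T.Pint (k + 1) (T.triv (k + 1)) W - T.Ecst (k + 1) - T.Rm (k + 1)) := by
    rw [lowerTriv_eq_exp]
    show Real.exp ((-(T.mainT (k + 1) (T.triv (k + 1)) W) + T.Pint (k + 1) (T.triv (k + 1)) W - (T.Ecst (k + 1) - E)) - T.Rm (k + 1)) = _
    rw [← Real.exp_add]
    congr 1
    ring
  have key : lowerTriv (h.dataT3v3 hc γ hγ hγ1 π) K (k + 1) W ≤ Real.exp E * rnTransport (((h.pkgAtV3 hc γ hγ hγ1 K).X).av k).avg f W := by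
    rw [hexp]
    refine mul_le_mul_of_nonneg_left ?_ (Real.exp_nonneg E)
    calc Real.exp (-(T.mainT (k + 1) (T.triv (k + 1)) W) + T.Pint (k + 1) (T.triv (k + 1)) W - T.Ecst (k + 1) - T.Rm (k + 1))
        ≤ Real.exp (-(T.mainT (k + 1) (T.triv (k + 1)) W) - T.Ecst k
            + (P.logσ₀ + P.dg * Real.log (T.g k)) * P.starB (T.triv (k + 1)) + P.logZU (T.triv (k + 1)) W
            + P.Pold (T.triv (k + 1)) W - T.Rm k + P.logFl (T.triv (k + 1)) W) := Real.exp_le_exp.mpr (hgath W)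
      _ = T.χ (k + 1) W * Real.exp (-(T.mainT (k + 1) (T.triv (k + 1)) W) - T.Ecst k
            + (P.logσ₀ + P.dg * Real.log (T.g k)) * P.starB (T.triv (k + 1)) + P.logZU (T.triv (k + 1)) W
            + P.Pold (T.triv (k + 1)) W - T.Rm k + P.logFl (T.triv (k + 1)) W) := by rw [hχ1, one_mul]
      _ ≤ rnTransport (((h.pkgAtV3 hc γ hγ hγ1 K).X).av k).avg f W := h57W
  exact key.trans (le_of_eq hhomW.symm)

end Summit.QuantumFields.YangMills.Theorems

end
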